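import Literature.AlgebraicGeometry.ShimuraVarieties.HeckeCorrespondenceAction
import Mathlib.Topology.Algebra.ConstMulAction

/-!
# A torsion-free `Γ` acting properly discontinuously on the ball acts FREELY (crux
# `EndoscopicMiddleDegree.OrthogonalEnveloped`, stmt-HodgeConjecture-14300; `--supports`; seat c2, 2026-08-16)

Half of the untyped prerequisite (G1) "`Γ` acts freely and properly discontinuously on `𝔹`" of the residual
construction stub `stub_heckeGraphAnalytic` (and of `stub_levelCoveringOfProperlyDiscontinuous`, landed
p107526) is FORMAL once the other half is granted: the stabiliser of a point under a properly
discontinuous action is finite (take `K = L = {b}` in `ProperlyDiscontinuousSMul.finite_disjoint_inter_image`),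
so each of its elements has finite order, hence is trivial by the datum's field `torsionFree` (BMM Part 2
§1.4: "`K` neat, so that `Γ` is torsion free and acts freely"). So (G1) = proper discontinuity alone
(plus the point-set topology of `𝔹`).

* `stub_freeOfProperlyDiscontinuous` (REGISTERED stub of the crux): `ProperlyDiscontinuousSMul ↥D.Γ D.ball →
  IsCancelSMul ↥D.Γ D.ball`.

References: BMM arXiv:1306.1515 Part 2 §1.4; Shimura 1971 §1.5 (fixed points of elements of finite order).
-/

noncomputable section

-- The crux-workfile namespace `Summit.<P>.<Sub>.Cruxes.…` repeats `HodgeConjecture` (single-conjunct summit).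
set_option linter.dupNamespace false

namespace Summit.HodgeConjecture.HodgeConjecture.Cruxes.OrthogonalEnveloped.HeckeGraphChow

open Literature.AlgebraicGeometry.Motives (SchemeOver)
open Literature.AlgebraicGeometry.ShimuraVarieties

/-- **REGISTERED STUB `stub_freeOfProperlyDiscontinuous` (seat c2): a torsion-free `Γ` acting properly
discontinuously on the ball acts freely.** If `γ • b = b` then every power `γⁿ` moves the compact set
`{b}` onto itself, so lies in the FINITE set `{δ | δ • {b} ∩ {b} ≠ ∅}` (proper discontinuity); hence
`n ↦ γⁿ` is not injective, `γ` has finite order, and `γ = 1` by `torsionFree`.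
[cite: BergeronMillsonMoeglin2016Balls, Part 2 §1.4] [cite: Shimura1973, §1.5] -/
theorem stub_freeOfProperlyDiscontinuous :
    ∀ {p : ℕ} {X : SchemeOver ℂ} (D : UnitaryBallQuotientDatum p X)
      [ProperlyDiscontinuousSMul ↥D.Γ D.ball], IsCancelSMul ↥D.Γ D.ball := by
  intro p X D _
  refine isCancelSMul_iff_eq_one_of_smul_eq.2 fun γ b hb ↦ ?_
  -- the finite set of elements moving `{b}` onto `{b}`
  have hfin : Set.Finite {δ : ↥D.Γ | ((fun x : D.ball ↦ δ • x) '' {b} ∩ {b}).Nonempty} :=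
    ProperlyDiscontinuousSMul.finite_disjoint_inter_image isCompact_singleton isCompact_singleton
  -- all powers of `γ` fix `b`, hence lie in it
  have hfix : ∀ n : ℕ, (γ ^ n) • b = b := by
    intro n
    induction n with
    | zero => rw [pow_zero, one_smul]
    | succ n ih => rw [pow_succ, mul_smul, hb, ih]
  have hpow : ∀ n : ℕ, γ ^ n ∈ {δ : ↥D.Γ | ((fun x : D.ball ↦ δ • x) '' {b} ∩ {b}).Nonempty} := by
    intro n
    simp only [Set.mem_setOf_eq, Set.image_singleton, hfix n, Set.inter_self]
    exact Set.singleton_nonempty b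
  -- so `γ` has finite order …
  have hord : IsOfFinOrder γ := by
    by_contra h
    exact (Set.infinite_of_injective_forall_mem (injective_pow_iff_not_isOfFinOrder.2 h) hpow) hfin
  -- … and is trivial, `Γ` being torsion free
  have h1 : (γ : GL (Fin (p + 1)) D.E) = 1 := D.torsionFree γ γ.2 (D.Γ.subtype.isOfFinOrder hord)
  exact Subtype.ext h1

end Summit.HodgeConjecture.HodgeConjecture.Cruxes.OrthogonalEnveloped.HeckeGraphChow

end
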